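import Mathlib

/-!
# The axisymmetric (m = 0) mode of the linearised cone equation at the swirling linear cones:
# pole indicial data and the logarithmic resonance (K20)

Solo seat `solo-NavierStokesRegularity-informed`, session 13; companion of
`paper/swirling-cone-linearisation.md` (Proposition 11(c)). In the unknowns `X = (a, q, W, Γ)` the
`m = 0` mode system at the north pole reads `φ X' = (G₀ + φ² G₂ + O(φ⁴)) X` (the coefficient matrix is
even in `φ`), with
`G₀ = [[2, 4/3, 0, -4b/3], [0, 0, -3, 2b], [0, 0, 0, 0], [0, 0, 4b/3, 2]]`,
`G₂ = [[-2/3, 8/9, 0, -2b/3], [-3/2, 0, 3/2, -b], [-3, 0, 1/3, 0], [4b/3, 0, 2b/9, -1/3]]`.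
Certified here (pure linear algebra; the Taylor coefficients are derived in the note):
* `m0_pole_kernel`: `ker G₀` is the line through `e₀ = (-2/3, 1, 0, 0)` (exponent 0 has geometric
  multiplicity one although algebraic multiplicity two: a Jordan block, i.e. a `log φ` solution — the
  singular polar cap), and `m0_pole_jordan` exhibits the Jordan partner with `W = -3/(9 + 4b²)`;
* `m0_pole_kernel_two`: `ker (2 - G₀) = {q = b Γ, W = 0}` is two-dimensional (the smooth germs);
* `m0_pole_logResonance`: the order-two Frobenius equation for the exponent-0 eigen-solution,
  `(2 - G₀) X₂ = G₂ e₀ = (4/3, 1, 2, -8b/9)`, has NO solution when `b ≠ 0` (so that solution carries a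
  `φ² log φ` term and is not smooth), and `m0_pole_logResonance_b0` shows it is solvable at `b = 0`.
Consequently, for `b ≠ 0` the germs at the pole of smooth `m = 0` linearised solutions form exactly the
two-dimensional exponent-2 family. No new definitions; axioms: standard.
-/

namespace Summit.NavierStokesRegularity.NavierStokesRegularity.Theorems

/-- `ker G₀` is spanned by `e₀ = (-2/3, 1, 0, 0)`. -/
theorem m0_pole_kernel (b a q W Γ : ℝ) :
    Matrix.mulVec !![2, 4/3, 0, -4*b/3; 0, 0, -3, 2*b; 0, 0, 0, 0; 0, 0, 4*b/3, (2:ℝ)] ![a, q, W, Γ] = 0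
      ↔ (W = 0 ∧ Γ = 0 ∧ a = -(2/3) * q) := by
  constructor
  · intro h
    have h0 := congrFun h 0
    have h1 := congrFun h 1
    have h3 := congrFun h 3
    simp [Matrix.mulVec, dotProduct, Fin.sum_univ_four] at h0 h1 h3
    have hΓ : Γ = 0 := by nlinarith [h1, h3, sq_nonneg b, sq_nonneg Γ, sq_nonneg (b*Γ), sq_nonneg W]
    subst hΓ
    have hW : W = 0 := by linarith
    subst hW
    refine ⟨rfl, rfl, ?_⟩
    linarith
  · rintro ⟨rfl, rfl, rfl⟩
    ext i
    fin_cases i <;> simp [Matrix.mulVec, dotProduct, Fin.sum_univ_four]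
    ring

/-- The Jordan partner: `G₀ e₀' = e₀` with `e₀' = (-3/(9+4b²), 0, -3/(9+4b²), 2b/(9+4b²))`
(so exponent 0 carries a `log φ` solution whose `W`-component is `-3/(9+4b²) ≠ 0`: the singular cap). -/
theorem m0_pole_jordan (b : ℝ) :
    Matrix.mulVec !![2, 4/3, 0, -4*b/3; 0, 0, -3, 2*b; 0, 0, 0, 0; 0, 0, 4*b/3, (2:ℝ)]
      ![-3/(9+4*b^2), 0, -3/(9+4*b^2), 2*b/(9+4*b^2)] = ![-(2/3 : ℝ), 1, 0, 0] := by
  have h9 : (9:ℝ) + 4*b^2 ≠ 0 := by positivity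
  ext i
  fin_cases i <;> simp [Matrix.mulVec, dotProduct, Fin.sum_univ_four] <;> field_simp <;> ring

/-- `ker (2 - G₀)` is the plane `{q = b Γ, W = 0}` (`a`, `Γ` free): the smooth exponent-2 germs. -/
theorem m0_pole_kernel_two (b a q W Γ : ℝ) :
    Matrix.mulVec !![0, -4/3, 0, 4*b/3; 0, 2, 3, -2*b; 0, 0, 2, 0; 0, 0, -4*b/3, (0:ℝ)] ![a, q, W, Γ] = 0
      ↔ (q = b * Γ ∧ W = 0) := by
  constructor
  · intro h
    have h0 := congrFun h 0
    have h2 := congrFun h 2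
    simp [Matrix.mulVec, dotProduct, Fin.sum_univ_four] at h0 h2
    constructor <;> linarith
  · rintro ⟨rfl, rfl⟩
    ext i
    fin_cases i <;> simp [Matrix.mulVec, dotProduct, Fin.sum_univ_four] <;> ring

/-- The matrix used in `m0_pole_kernel_two` / `m0_pole_logResonance` is `2·1 - G₀`. -/
theorem m0_pole_twoSub (b : ℝ) :
    (!![0, -4/3, 0, 4*b/3; 0, 2, 3, -2*b; 0, 0, 2, 0; 0, 0, -4*b/3, (0:ℝ)] : Matrix (Fin 4) (Fin 4) ℝ)
      = (2:ℝ) • (1 : Matrix (Fin 4) (Fin 4) ℝ)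
        - !![2, 4/3, 0, -4*b/3; 0, 0, -3, 2*b; 0, 0, 0, 0; 0, 0, 4*b/3, (2:ℝ)] := by
  ext i j
  fin_cases i <;> fin_cases j <;> simp <;> ring

/-- Logarithmic resonance at order two: for `b ≠ 0` the equation `(2 - G₀) X = G₂ e₀ = (4/3, 1, 2, -8b/9)`
has no solution. -/
theorem m0_pole_logResonance {b : ℝ} (hb : b ≠ 0) (X : Fin 4 → ℝ) :
    Matrix.mulVec !![0, -4/3, 0, 4*b/3; 0, 2, 3, -2*b; 0, 0, 2, 0; 0, 0, -4*b/3, (0:ℝ)] X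
      ≠ ![(4/3 : ℝ), 1, 2, -8*b/9] := by
  intro h
  have h2 := congrFun h 2
  have h3 := congrFun h 3
  simp [Matrix.mulVec, dotProduct, Fin.sum_univ_four] at h2 h3
  apply hb
  have hX2 : X 2 = 1 := by linarith
  rw [hX2] at h3
  linarith

/-- … whereas at `b = 0` it is solvable (e.g. `X = (0, -1, 1, 0)`), matching the extra smooth axisymmetric
solutions of the non-swirling cone. -/
theorem m0_pole_logResonance_b0 :
    Matrix.mulVec !![0, -4/3, 0, 4*(0:ℝ)/3; 0, 2, 3, -2*(0:ℝ); 0, 0, 2, 0; 0, 0, -4*(0:ℝ)/3, (0:ℝ)]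
      ![(0:ℝ), -1, 1, 0] = ![(4/3 : ℝ), 1, 2, -8*(0:ℝ)/9] := by
  ext i
  fin_cases i <;> simp [Matrix.mulVec, dotProduct, Fin.sum_univ_four] <;> norm_num

/-- `G₂ e₀ = (4/3, 1, 2, -8b/9)` for `e₀ = (-2/3, 1, 0, 0)`. -/
theorem m0_pole_G2e0 (b : ℝ) :
    Matrix.mulVec !![-2/3, 8/9, 0, -2*b/3; -3/2, 0, 3/2, -b; -3, 0, 1/3, 0; 4*b/3, 0, 2*b/9, -(1/3 : ℝ)]
      ![-(2/3 : ℝ), 1, 0, 0] = ![(4/3 : ℝ), 1, 2, -8*b/9] := by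
  ext i
  fin_cases i <;> simp [Matrix.mulVec, dotProduct, Fin.sum_univ_four] <;> ring

end Summit.NavierStokesRegularity.NavierStokesRegularity.Theorems
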